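import Literature.Computability.Complexity.Williams2014ClauseBit
import Literature.Computability.Complexity.Williams2014ValueCircuit
import Literature.Computability.Complexity.ParsimoniousCookLevin
import HarnessLib

/-!
# Williams' generator `A` (Lemma 3.1), part 3: the terms of VALUE and their semantics

R. Williams, *Nonuniform ACC circuit lower bounds*, J. ACM 61 (2014), proof of Lemma 3.1
(pp. 10–12). The machine `A` of the tree guesses, for every clause coordinate `κ` and polarity
`pol`, a family of `ACC` circuits — one per tableau variable `(b, v)` (block `b < R`, value `v`)
of the Cook–Levin tableau (`CookLevinTableau.lean`) of the clause-bit machine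
(`Williams2014ClauseBit.lean`) on the instance word `x'_{κ,pol}` — and checks them with ONE
satisfiability call on the DNF circuit VALUE of `Williams2014ValueCircuit.lean`. This file fixes

* the **numerology** of the construction as functions of `n = |x|` (`nX`, `TT`, `RBn`, `Rn`,
  `NVn`, the variable index `rIdx`, the output variable index `rOut`), the instance words by
  position (`xq'`, `xq_eq_xq'`);
* the **terms of VALUE** (`selLit`, `varLit`, `clauseTerm`, `pinTerms`, `famTerms`, `allTerms`):
  for family `φ = 2p + pol` the guard literal (output circuit of family `2p`, negated iff `pol`),
  one term per Cook–Levin clause ("the clause is violated under the guessed values") and two per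
  certificate cell ("the cell is not pinned to the input bit");
* their **semantics** (`dnfVal_allTerms_eq_false_iff`): VALUE is identically `0` iff for every
  family whose guard is on, the guessed assignment `τ` satisfies every clause and is pinned;
* **soundness** (`blockVal_out_eq_clauseMap`): then the output circuits compute the clause map
  (`Tableau.clauseMap_eq_of_checks`); and **completeness** (`exists_goodFamilies`): under
  `PHasAccCircuits m d` the intended tableau circuits (`Tableau.exists_tableauCircuits_acc`) make
  VALUE identically `0` (`Tableau.complete`, `Tableau.pinned_intended`), with the block indices of
  all clause variables in range (`Tableau.inRange_of_mem_clauses`).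

All statements are proved; no named fact is introduced.

## References

* R. Williams, *Nonuniform ACC circuit lower bounds*, J. ACM 61 (2014) 2:1–2:32, Lemma 3.1 and its
  proof (pp. 10–12) [Williams2014].
* M. Sipser, *Introduction to the Theory of Computation*, 3rd ed. 2012, Thm. 7.37 (tableau)
  [Sipser2012].
-/

noncomputable section

namespace Literature.Computability.Complexity

open Turing _root_.Computability Polynomial

/-! ### Block indices of the Cook–Levin clauses are in range -/

namespace Tableau

attribute [local instance] Turing.FinTM2.kFin Turing.FinTM2.ΛFin Turing.FinTM2.σFin
  Turing.FinTM2.Γk₀Fin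

variable {M : TM2ComputableAux Bool Bool}

section Range

variable (M) (n P T : ℕ)

/-- A tableau block of a row `t ≤ T` is below `(T + 1) · RB`. [folklore] -/
theorem blk_lt {t J : ℕ} (ht : t ≤ T) (hJ : J ≤ S1 M n P T) : blk M n P T t J < (T + 1) * RB M n P T := by
  have hRB : RB M n P T = S1 M n P T + 1 := rfl
  unfold blk
  rw [hRB] at *
  have : t * (S1 M n P T + 1) ≤ T * (S1 M n P T + 1) := Nat.mul_le_mul_right _ ht
  nlinarith

/-- `S₁` unfolded. [folklore] -/
theorem S1_unfold : S1 M n P T = 2 * n + 2 + P + dM M * T + 3 * dM M := rfl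

/-- `1 ≤ d`. [folklore] -/
theorem one_le_dM : 1 ≤ dM M := by have := depth_lt_dM M; unfold dM; omega

variable {n P T}

/-- **Every Cook–Levin clause mentions only blocks below `(T + 1) · RB`** (rows `0 … T`, blocks
`0 … S₁` of each row; from `Tableau.inRange_of_mem_clauses`, `ParsimoniousCookLevin.lean`).
[cite: Sipser2012, Thm. 7.37 (proof)] -/
theorem fst_lt_of_mem_clauses {x : List Bool} {C : HClause (TVar M)} (h : C ∈ clauses M P T x)
    {bv : TVar M} (hbv : bv ∈ C.1 ++ C.2) : bv.1 < (T + 1) * RB M x.length P T := by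
  obtain ⟨t, ht, J, hJ, h1⟩ := inRange_of_mem_clauses h (List.mem_append.1 hbv)
  rw [h1]
  exact blk_lt M _ P T ht hJ

end Range

section Counts

variable (M) (n P T : ℕ)

/-- The number of top clauses of a row (a constant of the machine). [folklore] -/
def nTop : ℕ := (allTuples M (3 * dM M + 1)).length * (2 * dM M + 1)

/-- The number of interior clauses of a block of a row (a constant of the machine). [folklore] -/
def nInt : ℕ := (allTuples M (dM M + 1)).length * (allTuples M (2 * dM M + 1)).length

/-- A bound on the number of exactly-one clauses of a block (a constant of the machine). [folklore] -/
def nCell : ℕ := 1 + (allVals M).length * (allVals M).length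

/-- The widest clause: `3 d + 2 + V` literals. [folklore] -/
def cw : ℕ := 3 * dM M + 2 + (allVals M).length

/-- **A bound on the number of Cook–Levin clauses** (polynomial in `n`, `P`, `T`). [folklore] -/
def clausesBound : ℕ :=
  2 * n + (3 + 2 * P + (dM M * T + 3 * dM M)) +
    T * (nTop M + (NN n P + dM M * T) * nInt M + dM M) + (T + 1) * (S1 M n P T + 1) * nCell M + 1

variable {n P T}

/-- `|xClauses x| = 2|x|`. [folklore] -/
theorem length_xClauses (x : List Bool) : (xClauses M x.length P T x).length = 2 * x.length := by
  simp [xClauses, bitClauses, List.length_flatMap, List.map_const', List.sum_replicate, List.length_zipIdx]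
  ring

/-- `|startClauses|`. [folklore] -/
theorem length_startClauses : (startClauses M n P T).length = 3 + 2 * P + (dM M * T + 3 * dM M) := by
  simp [startClauses, List.length_flatMap, List.map_const', List.sum_replicate]
  ring

/-- `|topClauses t| = nTop`. [folklore] -/
theorem length_topClauses (t : ℕ) : (topClauses M n P T t).length = nTop M := by
  simp [topClauses, nTop, List.length_flatMap, List.map_const', List.sum_replicate]

/-- `|intClauses t j| = nInt`. [folklore] -/
theorem length_intClauses (t j : ℕ) : (intClauses M n P T t j).length = nInt M := by
  simp [intClauses, nInt, List.length_flatMap, List.map_const', List.sum_replicate]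

/-- `|botClauses t| = d`. [folklore] -/
theorem length_botClauses (t : ℕ) : (botClauses M n P T t).length = dM M := by
  simp [botClauses]

/-- A `flatMap` of lists of length `≤ 1` is no longer than the list. [folklore] -/
theorem length_flatMap_le_of_le_one {α β : Type*} (l : List α) (f : α → List β) (h : ∀ a, (f a).length ≤ 1) :
    (l.flatMap f).length ≤ l.length := by
  induction l with
  | nil => simp
  | cons a l ih => simp only [List.flatMap_cons, List.length_append, List.length_cons]; have := h a; omega

/-- `|cellClauses t J| ≤ nCell`. [folklore] -/
theorem length_cellClauses_le (t J : ℕ) : (cellClauses M n P T t J).length ≤ nCell M := by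
  classical
  unfold cellClauses nCell
  simp only [List.length_cons]
  rw [Nat.add_comm]
  refine Nat.add_le_add_left ?_ 1
  rw [List.length_flatMap]
  calc ((allVals M).map fun v => ((allVals M).flatMap fun v' =>
          if v = v' then [] else [([(blk M n P T t J, v), (blk M n P T t J, v')], ([] : List (TVar M)))]).length).sum
      ≤ ((allVals M).map fun _ => (allVals M).length).sum := by
        refine List.sum_le_sum fun v _ => length_flatMap_le_of_le_one _ _ fun v' => ?_
        split_ifs <;> simp
    _ = (allVals M).length * (allVals M).length := by
        rw [List.map_const', List.sum_replicate, smul_eq_mul]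

/-- **`|clauses M P T x| ≤ clausesBound`.** [folklore] -/
theorem length_clauses_le (x : List Bool) : (clauses M P T x).length ≤ clausesBound M x.length P T := by
  have h1 := length_xClauses M (P := P) (T := T) x
  have h2 := length_startClauses M (n := x.length) (P := P) (T := T)
  have hmove : ((List.range T).flatMap fun t => topClauses M x.length P T t ++
      ((List.range (NN x.length P + dM M * T)).flatMap fun j => intClauses M x.length P T t j) ++
      botClauses M x.length P T t).length = T * (nTop M + (NN x.length P + dM M * T) * nInt M + dM M) := by
    rw [List.length_flatMap]
    rw [show (List.range T).map (fun t => (topClauses M x.length P T t ++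
        ((List.range (NN x.length P + dM M * T)).flatMap fun j => intClauses M x.length P T t j) ++
        botClauses M x.length P T t).length) =
        (List.range T).map (fun _ => nTop M + (NN x.length P + dM M * T) * nInt M + dM M) from
      List.map_congr_left fun t _ => by
        rw [List.length_append, List.length_append, length_topClauses, length_botClauses, List.length_flatMap,
          show (List.range (NN x.length P + dM M * T)).map (fun j => (intClauses M x.length P T t j).length) =
            (List.range (NN x.length P + dM M * T)).map (fun _ => nInt M) from
            List.map_congr_left fun j _ => length_intClauses M t j,
          List.map_const', List.sum_replicate, smul_eq_mul, List.length_range]]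
    rw [List.map_const', List.sum_replicate, smul_eq_mul, List.length_range]
  have hcell : ((List.range (T + 1)).flatMap fun t => (List.range (S1 M x.length P T + 1)).flatMap fun J =>
      cellClauses M x.length P T t J).length ≤ (T + 1) * (S1 M x.length P T + 1) * nCell M := by
    rw [List.length_flatMap]
    calc ((List.range (T + 1)).map fun t => ((List.range (S1 M x.length P T + 1)).flatMap fun J =>
            cellClauses M x.length P T t J).length).sum
        ≤ ((List.range (T + 1)).map fun _ => (S1 M x.length P T + 1) * nCell M).sum := by
          refine List.sum_le_sum fun t _ => ?_
          rw [List.length_flatMap]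
          calc ((List.range (S1 M x.length P T + 1)).map fun J => (cellClauses M x.length P T t J).length).sum
              ≤ ((List.range (S1 M x.length P T + 1)).map fun _ => nCell M).sum :=
                List.sum_le_sum fun J _ => length_cellClauses_le M t J
            _ = (S1 M x.length P T + 1) * nCell M := by
                rw [List.map_const', List.sum_replicate, smul_eq_mul, List.length_range]
      _ = (T + 1) * (S1 M x.length P T + 1) * nCell M := by
          rw [List.map_const', List.sum_replicate, smul_eq_mul, List.length_range, Nat.mul_assoc]
  unfold clauses nClauses clausesBound
  simp only [List.length_append, List.length_singleton]
  rw [h1, h2, hmove]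
  omega

/-- **Clauses are narrow**: at most `cw = 3d + 2 + V` literals. [folklore] -/
theorem width_le_of_mem_clauses {x : List Bool} {C : HClause (TVar M)} (h : C ∈ clauses M P T x) :
    C.1.length + C.2.length ≤ cw M := by
  classical
  have hV : 1 ≤ (allVals M).length := List.length_pos_of_mem (mem_allVals M (ctrlVal M))
  have hd := one_le_dM M
  unfold clauses xClauses nClauses at h
  simp only [List.mem_append, List.mem_flatMap, List.mem_range, List.mem_singleton] at h
  unfold cw
  rcases h with ⟨⟨b, i⟩, -, h⟩ | ((h | ⟨t, -, (h | ⟨j, -, h⟩) | h⟩) | ⟨t, -, J, -, h⟩) | rfl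
  · simp only [bitClauses, List.mem_cons, List.mem_nil_iff, or_false] at h
    rcases h with rfl | rfl <;> simp <;> omega
  · simp only [startClauses, List.mem_append, List.mem_cons, List.mem_nil_iff, or_false, List.mem_flatMap,
      List.mem_range, List.mem_map] at h
    rcases h with ((rfl | rfl | rfl) | ⟨j, -, rfl | rfl⟩) | ⟨j, -, rfl⟩ <;> simp <;> omega
  · simp only [topClauses, List.mem_flatMap, List.mem_map] at h
    obtain ⟨a, -, r, -, rfl⟩ := h
    simp
  · simp only [intClauses, List.mem_flatMap, List.mem_map] at h
    obtain ⟨hh, -, nb, -, rfl⟩ := h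
    simp; omega
  · simp only [botClauses, List.mem_map, List.mem_range] at h
    obtain ⟨r, -, rfl⟩ := h
    simp; omega
  · simp only [cellClauses, List.mem_cons, List.mem_flatMap] at h
    rcases h with rfl | ⟨v, -, v', -, hC⟩
    · simp
    · split_ifs at hC with hvv
      · simp at hC
      · simp only [List.mem_singleton] at hC
        subst hC
        simp; omega
  · simp; omega

end Counts

/-- Truth of a clause depends only on the values of its variables. [folklore] -/
theorem HClause.holds_congr {ν : Type} {τ τ' : ν → Bool} {C : _root_.Literature.Computability.Complexity.HClause ν}
    (h : ∀ v ∈ C.1 ++ C.2, τ v = τ' v) :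
    _root_.Literature.Computability.Complexity.HClause.Holds τ C ↔
      _root_.Literature.Computability.Complexity.HClause.Holds τ' C := by
  unfold HClause.Holds
  have h1 : ∀ v ∈ C.1, τ v = τ' v := fun v hv => h v (List.mem_append_left _ hv)
  have h2 : ∀ v ∈ C.2, τ v = τ' v := fun v hv => h v (List.mem_append_right _ hv)
  constructor
  · intro H hp
    obtain ⟨v, hv, hvt⟩ := H fun v hv => (h1 v hv).trans (hp v hv)
    exact ⟨v, hv, (h2 v hv) ▸ hvt⟩
  · intro H hp
    obtain ⟨v, hv, hvt⟩ := H fun v hv => (h1 v hv).symm.trans (hp v hv)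
    exact ⟨v, hv, (h2 v hv).symm ▸ hvt⟩

end Tableau

/-! ### The numerology of `A` -/

namespace MachineA

open Tableau GateList

attribute [local instance] Turing.FinTM2.kFin Turing.FinTM2.ΛFin Turing.FinTM2.σFin
  Turing.FinTM2.Γk₀Fin

section Params

variable (c : ℕ) (M : TM2ComputableAux Bool Bool) (pT : Polynomial ℕ)

/-- The common length `|x'| = 2n + 2w + 21` of the instance words (`length_xq`). [folklore] -/
def nX (c n : ℕ) : ℕ := 2 * n + 2 * succinctWidth c n + 21

/-- The time bound `T = p_T(2|x'| + 2 + w)` of the clause-bit machine on `⟨x', u⟩`, `|u| = w`.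
[folklore] -/
def TT (n : ℕ) : ℕ := pT.eval (2 * nX c n + 2 + succinctWidth c n)

/-- The row width `RB` of the tableau (certificate length `P = w`). [folklore] -/
def RBn (n : ℕ) : ℕ := RB M (nX c n) (succinctWidth c n) (TT c pT n)

/-- The number of tableau blocks `R = (T + 1) · RB`. [folklore] -/
def Rn (n : ℕ) : ℕ := (TT c pT n + 1) * RBn c M pT n

/-- The number of block values `V`. [folklore] -/
def Vc : ℕ := Nat.card (Val M.tm)

/-- The number of tableau variables `NV = R · V` (circuits per guessed family). [folklore] -/
def NVn (n : ℕ) : ℕ := Rn c M pT n * Vc M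

/-- The index of the tableau variable `(b, v)` within a family: `b · V + #v`. [folklore] -/
def rIdx (bv : TVar M) : ℕ := bv.1 * Vc M + ((valEquiv M) bv.2 : ℕ)

/-- The output variable "block `1` of row `T` holds the accepting value". [folklore] -/
def outVar (n : ℕ) : TVar M := (blk M (nX c n) (succinctWidth c n) (TT c pT n) (TT c pT n) 1, accVal M)

/-- The index of the output variable. [folklore] -/
def rOut (n : ℕ) : ℕ := rIdx M (outVar c M pT n)

/-- The number of families `2 · 3 (w + 2)` (coordinates times polarities). [folklore] -/
def nFam (c n : ℕ) : ℕ := 2 * (3 * (succinctWidth c n + 2))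

variable {M}

/-- Variable indices of blocks below `R` are below `NV`. [folklore] -/
theorem rIdx_lt {n : ℕ} {bv : TVar M} (h : bv.1 < Rn c M pT n) : rIdx M bv < NVn c M pT n := by
  unfold rIdx NVn Vc
  have hv := ((valEquiv M) bv.2).isLt
  calc bv.1 * Nat.card (Val M.tm) + ((valEquiv M) bv.2 : ℕ)
      < bv.1 * Nat.card (Val M.tm) + Nat.card (Val M.tm) := by omega
    _ = (bv.1 + 1) * Nat.card (Val M.tm) := by ring
    _ ≤ Rn c M pT n * Nat.card (Val M.tm) := Nat.mul_le_mul_right _ h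

/-- The block of a variable index. [folklore] -/
theorem rIdx_div (bv : TVar M) : rIdx M bv / Vc M = bv.1 := by
  unfold rIdx Vc
  have hv := ((valEquiv M) bv.2).isLt
  rw [Nat.add_comm, Nat.add_mul_div_right _ _ (by omega), Nat.div_eq_of_lt hv, Nat.zero_add]

/-- The value number of a variable index. [folklore] -/
theorem rIdx_mod (bv : TVar M) : rIdx M bv % Vc M = ((valEquiv M) bv.2 : ℕ) := by
  unfold rIdx Vc
  have hv := ((valEquiv M) bv.2).isLt
  rw [Nat.add_comm, Nat.add_mul_mod_self_right, Nat.mod_eq_of_lt hv]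

/-- `rIdx` is injective. [folklore] -/
theorem rIdx_injective : Function.Injective (rIdx M) := by
  intro bv bv' h
  have h1 := rIdx_div (M := M) bv
  have h2 := rIdx_mod (M := M) bv
  rw [h] at h1 h2
  rw [rIdx_div] at h1
  rw [rIdx_mod] at h2
  refine Prod.ext h1.symm ?_
  have : (valEquiv M) bv'.2 = (valEquiv M) bv.2 := Fin.ext h2
  exact ((valEquiv M).injective this).symm

end Params

/-! ### Instance words by position -/

/-- The instance word of the coordinate at POSITION `p` (slot `p / (w+2)`, field `p % (w+2)`) and
polarity `pol`: `⟨x, ⟨⟨bin₂ (p / (w+2)), bin_{w+2} (p % (w+2))⟩, [pol]⟩⟩`. [folklore] -/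
def xq' (c : ℕ) (x : List Bool) (p : ℕ) (pol : Bool) : List Bool :=
  boolPair x (boolPair (boolPair (natPad (p / (succinctWidth c x.length + 2)) 2)
    (natPad (p % (succinctWidth c x.length + 2)) (succinctWidth c x.length + 2))) [pol])

/-- `fieldNum` is `fieldPos`. [folklore] -/
theorem fieldNum_eq_fieldPos {w : ℕ} (f : Bool ⊕ Fin w) : fieldNum f = WitnessCheck.fieldPos f := by
  rcases f with (_ | _) | j <;> rfl

/-- The instance word of `κ` is the instance word at position `coordPos κ`. [folklore] -/
theorem xq_eq_xq' (c : ℕ) (x : List Bool) (κ : ClauseCoord (succinctWidth c x.length)) (pol : Bool) :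
    xq c x κ pol = xq' c x (WitnessCheck.coordPos κ) pol := by
  have hf := WitnessCheck.fieldPos_lt κ.2
  have h1 : WitnessCheck.coordPos κ / (succinctWidth c x.length + 2) = (κ.1 : ℕ) := by
    unfold WitnessCheck.coordPos
    rw [Nat.add_comm, Nat.add_mul_div_right _ _ (Nat.succ_pos _), Nat.div_eq_of_lt hf, Nat.zero_add]
  have h2 : WitnessCheck.coordPos κ % (succinctWidth c x.length + 2) = WitnessCheck.fieldPos κ.2 := by
    unfold WitnessCheck.coordPos
    rw [Nat.add_comm, Nat.add_mul_mod_self_right, Nat.mod_eq_of_lt hf]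
  rw [xq', h1, h2, xq, coordCode, fieldNum_eq_fieldPos]

/-- All instance words at positions `p < 3 (w + 2)` have length `nX c n`. [folklore] -/
theorem length_xq' (c : ℕ) (x : List Bool) {p : ℕ} (hp : p < 3 * (succinctWidth c x.length + 2)) (pol : Bool) :
    (xq' c x p pol).length = nX c x.length := by
  have h1 : p / (succinctWidth c x.length + 2) ≤ 2 := by
    have : p / (succinctWidth c x.length + 2) < 3 :=
      Nat.div_lt_of_lt_mul (by rwa [Nat.mul_comm] at hp)
    omega
  have h2 : p % (succinctWidth c x.length + 2) ≤ succinctWidth c x.length + 2 :=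
    (Nat.mod_lt _ (Nat.succ_pos _)).le
  simp only [xq', length_boolPair, length_natPad h1, length_natPad h2, List.length_singleton, nX]
  ring

/-! ### The terms of VALUE -/

section Terms

variable (M : TM2ComputableAux Bool Bool)

/-- **The guard literal** of family `φ = 2p + pol`: the output circuit of family `2p` (variable
`rOut`), negated iff `pol = 1`. [cite: Williams2014, Lemma 3.1 (proof)] -/
def selLit (NV rO φ : ℕ) : Lit := (decide (φ % 2 = 1), false, φ / 2 * 2 * NV + rO)

/-- The literal of the tableau variable `bv` of family `φ`. [folklore] -/
def varLit (NV φ : ℕ) (neg : Bool) (bv : TVar M) : Lit := (neg, false, φ * NV + rIdx M bv)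

/-- **The term of a Cook–Levin clause**: guard on, all premises true, all conclusions false — "the
clause is violated by the guessed values". [cite: Williams2014, Lemma 3.1 (proof)] -/
def clauseTerm (NV rO φ : ℕ) (C : HClause (TVar M)) : List Lit :=
  selLit NV rO φ :: (C.1.map (varLit M NV φ false) ++ C.2.map (varLit M NV φ true))

/-- **The pin terms** of certificate cell `j`: guard on, input bit `j` is `b`, and the cell variable
"holds the symbol `b`" is false (`b = 1`, `b = 0`). [cite: Williams2014, Lemma 3.1 (proof)] -/
def pinTerms (NV rO φ n' P T j : ℕ) : List (List Lit) :=
  [[selLit NV rO φ, varLit M NV φ true (blk M n' P T 0 (2 * n' + 3 + j), symVal M true), (false, true, j)],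
   [selLit NV rO φ, varLit M NV φ true (blk M n' P T 0 (2 * n' + 3 + j), symVal M false), (true, true, j)]]

variable (c : ℕ) (pT : Polynomial ℕ)

/-- **The terms of family `φ`**: one per Cook–Levin clause of the clause-bit machine on
`x'_{p,pol}` (`p = φ / 2`, `pol = φ % 2`), certificate length `w`, time `T`; two pins per input bit.
[cite: Williams2014, Lemma 3.1 (proof)] -/
def famTerms (x : List Bool) (φ : ℕ) : List (List Lit) :=
  (clauses M (succinctWidth c x.length) (TT c pT x.length) (xq' c x (φ / 2) (decide (φ % 2 = 1)))).map
      (clauseTerm M (NVn c M pT x.length) (rOut c M pT x.length) φ) ++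
    (List.range (succinctWidth c x.length)).flatMap
      (pinTerms M (NVn c M pT x.length) (rOut c M pT x.length) φ (nX c x.length) (succinctWidth c x.length)
        (TT c pT x.length))

/-- **All terms of VALUE** at input `x`: the families `φ < 2 · 3 (w + 2)`. [cite: Williams2014, Lemma 3.1 (proof)] -/
def allTerms (x : List Bool) : List (List Lit) :=
  (List.range (nFam c x.length)).flatMap (famTerms M c pT x)

end Terms

/-! ### Semantics of the terms -/

section Semantics

variable {M : TM2ComputableAux Bool Bool} {w : ℕ}

/-- **The assignment guessed by family `φ`**: variable `bv` is the value of block `φ · NV + rIdx bv`.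
[cite: Williams2014, Lemma 3.1 (proof)] -/
def τ (M : TM2ComputableAux Bool Bool) (NV : ℕ) (blocks : List (Circuit (Fin w))) (φ : ℕ)
    (u : Fin w → Bool) : TVar M → Bool :=
  fun bv => blockVal blocks u (φ * NV + rIdx M bv)

variable (blocks : List (Circuit (Fin w))) (u : Fin w → Bool)

/-- The value of a variable literal. [folklore] -/
@[simp] theorem litVal_varLit (NV φ : ℕ) (neg : Bool) (bv : TVar M) :
    litVal blocks u (varLit M NV φ neg bv) = xor (τ M NV blocks φ u bv) neg := rfl

/-- The value of the guard literal: the output block of family `2 (φ / 2)`, flipped iff `φ` is odd.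
[folklore] -/
@[simp] theorem litVal_selLit (NV rO φ : ℕ) :
    litVal blocks u (selLit NV rO φ) = xor (blockVal blocks u (φ / 2 * 2 * NV + rO)) (decide (φ % 2 = 1)) := rfl

/-- **A clause term fires iff the guard is on and the clause is violated.** [folklore] -/
theorem all_clauseTerm_iff (NV rO φ : ℕ) (C : HClause (TVar M)) :
    (clauseTerm M NV rO φ C).all (litVal blocks u) = true ↔
      litVal blocks u (selLit NV rO φ) = true ∧ ¬ HClause.Holds (τ M NV blocks φ u) C := by
  unfold clauseTerm HClause.Holds
  rw [List.all_cons, Bool.and_eq_true, List.all_append, Bool.and_eq_true, List.all_map, List.all_map,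
    List.all_eq_true, List.all_eq_true]
  simp only [Function.comp_apply, litVal_varLit, Bool.xor_false, Bool.xor_true, Bool.not_eq_true']
  constructor
  · rintro ⟨hs, h1, h2⟩
    refine ⟨hs, fun H => ?_⟩
    obtain ⟨v, hv, hvt⟩ := H h1
    rw [h2 v hv] at hvt
    exact Bool.false_ne_true hvt
  · rintro ⟨hs, hH⟩
    obtain ⟨h1, h2⟩ := Classical.not_imp.1 hH
    exact ⟨hs, h1, fun v hv => Bool.eq_false_iff.2 fun h => h2 ⟨v, hv, h⟩⟩

/-- **A pin term of cell `j` fires iff the guard is on and the cell variable of the input bit is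
false.** [folklore] -/
theorem exists_pinTerms_iff (NV rO φ n' P T : ℕ) {j : ℕ} (hj : j < w) :
    (∃ t ∈ pinTerms M NV rO φ n' P T j, t.all (litVal blocks u) = true) ↔
      litVal blocks u (selLit NV rO φ) = true ∧
        τ M NV blocks φ u (blk M n' P T 0 (2 * n' + 3 + j), symVal M (u ⟨j, hj⟩)) = false := by
  simp only [pinTerms, List.mem_cons, List.mem_nil_iff, or_false, exists_eq_or_imp, exists_eq_left,
    List.all_cons, List.all_nil, Bool.and_true, Bool.and_eq_true, litVal_varLit, Bool.xor_true,
    Bool.not_eq_true']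
  have hin : ∀ ng : Bool, litVal blocks u (ng, true, j) = xor (u ⟨j, hj⟩) ng := by
    intro ng; simp [litVal, inputVal, hj]
  rw [hin, hin]
  cases hu : u ⟨j, hj⟩ <;> simp

/-- **The terms of a family fire iff its guard is on and the guessed assignment violates a clause or
a pin.** [cite: Williams2014, Lemma 3.1 (proof)] -/
theorem exists_famTerms_iff (c : ℕ) (pT : Polynomial ℕ) (x : List Bool)
    (blocks : List (Circuit (Fin (succinctWidth c x.length)))) (u : Fin (succinctWidth c x.length) → Bool)
    {φ : ℕ} (hφ : φ < nFam c x.length) :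
    (∃ t ∈ famTerms M c pT x φ, t.all (litVal blocks u) = true) ↔
      litVal blocks u (selLit (NVn c M pT x.length) (rOut c M pT x.length) φ) = true ∧
        ¬ ((∀ C ∈ clauses M (succinctWidth c x.length) (TT c pT x.length) (xq' c x (φ / 2) (decide (φ % 2 = 1))),
              HClause.Holds (τ M (NVn c M pT x.length) blocks φ u) C) ∧
            Pinned (τ M (NVn c M pT x.length) blocks φ u) (xq' c x (φ / 2) (decide (φ % 2 = 1)))
              (succinctWidth c x.length) (TT c pT x.length) (List.ofFn u)) := by
  have hp : φ / 2 < 3 * (succinctWidth c x.length + 2) := by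
    unfold nFam at hφ; omega
  have hlen := length_xq' c x hp (decide (φ % 2 = 1))
  constructor
  · rintro ⟨t, ht, hall⟩
    rw [famTerms, List.mem_append] at ht
    rcases ht with ht | ht
    · obtain ⟨C, hC, rfl⟩ := List.mem_map.1 ht
      obtain ⟨hs, hviol⟩ := (all_clauseTerm_iff blocks u _ _ φ C).1 hall
      exact ⟨hs, fun h => hviol (h.1 C hC)⟩
    · obtain ⟨j, hj, ht⟩ := List.mem_flatMap.1 ht
      rw [List.mem_range] at hj
      have := (exists_pinTerms_iff blocks u _ _ φ _ _ _ hj).1 ⟨t, ht, hall⟩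
      refine ⟨this.1, fun h => ?_⟩
      have hpin := h.2 j (by simp [hj])
      rw [hlen] at hpin
      simp only [List.getElem_ofFn] at hpin
      rw [this.2] at hpin
      exact Bool.false_ne_true hpin
  · rintro ⟨hs, hnot⟩
    by_cases hcl : ∀ C ∈ clauses M (succinctWidth c x.length) (TT c pT x.length)
        (xq' c x (φ / 2) (decide (φ % 2 = 1))), HClause.Holds (τ M (NVn c M pT x.length) blocks φ u) C
    · have hpin : ¬ Pinned (τ M (NVn c M pT x.length) blocks φ u) (xq' c x (φ / 2) (decide (φ % 2 = 1)))
          (succinctWidth c x.length) (TT c pT x.length) (List.ofFn u) := fun h => hnot ⟨hcl, h⟩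
      simp only [Pinned, not_forall] at hpin
      obtain ⟨j, hj, hfalse⟩ := hpin
      have hj' : j < succinctWidth c x.length := by simpa using hj
      rw [hlen] at hfalse
      simp only [List.getElem_ofFn, Bool.not_eq_true] at hfalse
      obtain ⟨t, ht, hall⟩ := (exists_pinTerms_iff blocks u _ _ φ _ _ _ hj').2 ⟨hs, hfalse⟩
      exact ⟨t, List.mem_append_right _ (List.mem_flatMap.2 ⟨j, List.mem_range.2 hj', ht⟩), hall⟩
    · simp only [not_forall] at hcl
      obtain ⟨C, hC, hv⟩ := hcl
      exact ⟨_, List.mem_append_left _ (List.mem_map.2 ⟨C, hC, rfl⟩),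
        (all_clauseTerm_iff blocks u _ _ φ C).2 ⟨hs, hv⟩⟩

/-- **VALUE is identically `0` iff every family whose guard is on satisfies all its clauses and
pins.** [cite: Williams2014, Lemma 3.1 (proof)] -/
theorem dnfVal_allTerms_eq_false_iff (c : ℕ) (pT : Polynomial ℕ) (x : List Bool)
    (blocks : List (Circuit (Fin (succinctWidth c x.length)))) (u : Fin (succinctWidth c x.length) → Bool) :
    dnfVal blocks (allTerms M c pT x) u = false ↔
      ∀ φ < nFam c x.length,
        litVal blocks u (selLit (NVn c M pT x.length) (rOut c M pT x.length) φ) = true →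
          (∀ C ∈ clauses M (succinctWidth c x.length) (TT c pT x.length) (xq' c x (φ / 2) (decide (φ % 2 = 1))),
              HClause.Holds (τ M (NVn c M pT x.length) blocks φ u) C) ∧
            Pinned (τ M (NVn c M pT x.length) blocks φ u) (xq' c x (φ / 2) (decide (φ % 2 = 1)))
              (succinctWidth c x.length) (TT c pT x.length) (List.ofFn u) := by
  rw [← Bool.not_eq_true, dnfVal, List.any_eq_true, not_exists]
  unfold allTerms
  constructor
  · intro h φ hφ hs
    by_contra hnot
    obtain ⟨t, ht, hall⟩ := (exists_famTerms_iff (M := M) c pT x blocks u hφ).2 ⟨hs, hnot⟩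
    exact h t ⟨List.mem_flatMap.2 ⟨φ, List.mem_range.2 hφ, ht⟩, hall⟩
  · rintro h t ⟨ht, hall⟩
    obtain ⟨φ, hφ, ht⟩ := List.mem_flatMap.1 ht
    rw [List.mem_range] at hφ
    have := (exists_famTerms_iff (M := M) c pT x blocks u hφ).1 ⟨t, ht, hall⟩
    exact this.2 (h φ hφ this.1)

end Semantics

/-! ### Soundness: an identically-zero VALUE makes the output circuits correct -/

section Sound

variable {M : TM2ComputableAux Bool Bool} {cl : List Bool → ℕ → Clause ℕ}

/-- The block index of the output circuit of coordinate position `p` (family `2p`). [folklore] -/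
def outIdx (c : ℕ) (M : TM2ComputableAux Bool Bool) (pT : Polynomial ℕ) (n p : ℕ) : ℕ :=
  2 * p * NVn c M pT n + rOut c M pT n

/-- The clause-bit machine meets the time bound `TT` on instance words. [folklore] -/
theorem outputsWithin_xq {pT : Polynomial ℕ} (hM : ∀ z, M.OutputsWithin z [bitFun cl z] (pT.eval z.length))
    (c : ℕ) (x : List Bool) (κ : ClauseCoord (succinctWidth c x.length)) (pol : Bool)
    (i : Fin (succinctWidth c x.length) → Bool) :
    M.OutputsWithin (boolPair (xq c x κ pol) (List.ofFn i))
      [bitFun cl (boolPair (xq c x κ pol) (List.ofFn i))] (TT c pT x.length) := by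
  have := hM (boolPair (xq c x κ pol) (List.ofFn i))
  rwa [length_boolPair, xq_eq_xq', length_xq' c x (WitnessCheck.coordPos_lt κ), List.length_ofFn,
    ← xq_eq_xq'] at this

/-- **Soundness of the check** (Williams 2014, proof of Lemma 3.1: VALUE unsatisfiable ⟹ the
printed circuit is equivalent to `Cₓ`). If VALUE is identically `0` on the guessed blocks, the
output block of every coordinate `κ` computes coordinate `κ` of the clause map of `cl x`.
[cite: Williams2014, Lemma 3.1 (proof)] -/
theorem blockVal_out_eq_clauseMap {pT : Polynomial ℕ}
    (hM : ∀ z, M.OutputsWithin z [bitFun cl z] (pT.eval z.length)) (c : ℕ) (x : List Bool)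
    (blocks : List (Circuit (Fin (succinctWidth c x.length))))
    (hunsat : ∀ u, dnfVal blocks (allTerms M c pT x) u = false)
    (κ : ClauseCoord (succinctWidth c x.length)) (i : Fin (succinctWidth c x.length) → Bool) :
    blockVal blocks i (outIdx c M pT x.length (WitnessCheck.coordPos κ)) = clauseMap _ (cl x) i κ := by
  have hp : WitnessCheck.coordPos κ < 3 * (succinctWidth c x.length + 2) := WitnessCheck.coordPos_lt κ
  have key := (dnfVal_allTerms_eq_false_iff (M := M) c pT x blocks i).1 (hunsat i)
  have e1 : 2 * WitnessCheck.coordPos κ / 2 = WitnessCheck.coordPos κ := by omega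
  have e2 : (2 * WitnessCheck.coordPos κ + 1) / 2 = WitnessCheck.coordPos κ := by omega
  have e3 : decide (2 * WitnessCheck.coordPos κ % 2 = 1) = false := by simp
  have e4 : decide ((2 * WitnessCheck.coordPos κ + 1) % 2 = 1) = true := by simp
  refine Tableau.clauseMap_eq_of_checks (M := M) κ i (fun pol => outputsWithin_xq hM c x κ pol i)
    (τ₀ := τ M (NVn c M pT x.length) blocks (2 * WitnessCheck.coordPos κ) i)
    (τ₁ := τ M (NVn c M pT x.length) blocks (2 * WitnessCheck.coordPos κ + 1) i)
    (g := blockVal blocks i (outIdx c M pT x.length (WitnessCheck.coordPos κ))) ?_ ?_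
  · intro hg
    have h := key (2 * WitnessCheck.coordPos κ) (by unfold nFam; omega) (by
      rw [litVal_selLit, e1, e3, Nat.mul_comm (WitnessCheck.coordPos κ) 2]; simpa [outIdx] using hg)
    rwa [e1, e3, ← xq_eq_xq'] at h
  · intro hg
    have h := key (2 * WitnessCheck.coordPos κ + 1) (by unfold nFam; omega) (by
      rw [litVal_selLit, e2, e4, Nat.mul_comm (WitnessCheck.coordPos κ) 2]; simpa [outIdx] using hg)
    rwa [e2, e4, ← xq_eq_xq'] at h

end Sound

/-! ### Completeness: the intended tableau circuits make VALUE identically zero -/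

section Complete

variable {M : TM2ComputableAux Bool Bool} {cl : List Bool → ℕ → Clause ℕ}

/-- `NV ≥ 1`. [folklore] -/
theorem NVn_pos (c : ℕ) (M : TM2ComputableAux Bool Bool) (pT : Polynomial ℕ) (n : ℕ) : 0 < NVn c M pT n := by
  unfold NVn Rn RBn Vc Tableau.RB
  have : 0 < Nat.card (Val M.tm) := Nat.card_pos
  positivity

/-- Indexing the flattened families. [folklore] -/
theorem blockVal_flatMap {w NV K : ℕ} (E : ℕ → ℕ → Circuit (Fin w)) (u : Fin w → Bool) {φ r : ℕ}
    (hφ : φ < K) (hr : r < NV) :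
    blockVal ((List.range K).flatMap fun φ => (List.range NV).map (E φ)) u (φ * NV + r) = (E φ r).eval u := by
  unfold blockVal
  have hlen : ((List.range K).flatMap fun φ => (List.range NV).map (E φ)).length = K * NV := by
    simp [List.length_flatMap, List.sum_replicate]
  have hlt : φ * NV + r < K * NV := by
    calc φ * NV + r < φ * NV + NV := by omega
      _ = (φ + 1) * NV := by ring
      _ ≤ K * NV := Nat.mul_le_mul_right _ hφ
  rw [dif_pos (by rw [hlen]; exact hlt)]
  rw [WitnessCheck.getElem_flatMap_blocks (fun φ => (List.range NV).map (E φ)) NV (fun _ => by simp)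
    (List.range K) φ r (φ * NV + r) (by simpa using hφ) hr rfl]
  simp

/-- A polynomial bound `|x'| + w + T ≤ bigPoly(n)` for the argument of the size polynomial. [folklore] -/
def bigPoly (c : ℕ) (pT : Polynomial ℕ) : Polynomial ℕ :=
  (Polynomial.C 2 * X + Polynomial.C 2 * MachineB.widthPoly c + Polynomial.C 21) + MachineB.widthPoly c +
    pT.comp (Polynomial.C 2 * (Polynomial.C 2 * X + Polynomial.C 2 * MachineB.widthPoly c + Polynomial.C 21) +
      Polynomial.C 2 + MachineB.widthPoly c)

/-- The bound `nX + w + T ≤ bigPoly(n)`. [folklore] -/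
theorem nX_add_le_bigPoly (c : ℕ) (pT : Polynomial ℕ) (n : ℕ) :
    nX c n + succinctWidth c n + TT c pT n ≤ (bigPoly c pT).eval n := by
  have hw := MachineB.succinctWidth_le_widthPoly c n
  have h1 : nX c n ≤ 2 * n + 2 * (MachineB.widthPoly c).eval n + 21 := by unfold nX; omega
  have h2 : TT c pT n ≤ pT.eval (2 * (2 * n + 2 * (MachineB.widthPoly c).eval n + 21) + 2 +
      (MachineB.widthPoly c).eval n) := natPoly_eval_mono pT (by unfold nX; omega)
  simp only [bigPoly, eval_add, eval_mul, eval_C, eval_X, eval_comp]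
  omega

/-- **Completeness of the check** (Williams 2014, proof of Lemma 3.1: "there is always at least
one computation path of `A(x)` that prints the circuit"). Under `PHasAccCircuits m d`, for every
input `x` there are families of `accBasis m`-circuits of depth `≤ d + 1` and polynomial size — the
intended tableau circuits of the runs of the clause-bit machine — on which VALUE is identically
`0`. [cite: Williams2014, Lemma 3.1 (proof)] -/
theorem exists_goodFamilies {m d : ℕ} (hm : 0 < m) (hP : PHasAccCircuits m d) {pT : Polynomial ℕ}
    (hM : ∀ z, M.OutputsWithin z [bitFun cl z] (pT.eval z.length)) (c : ℕ) :
    ∃ q : Polynomial ℕ, ∀ x : List Bool, ∃ E : ℕ → ℕ → Circuit (Fin (succinctWidth c x.length)),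
      (∀ φ r, (E φ r).IsOver (accBasis m) ∧ (E φ r).acDepth ≤ d + 1 ∧ (E φ r).size ≤ q.eval x.length ∧
        (E φ r).maxFanIn ≤ m * (succinctWidth c x.length + q.eval x.length)) ∧
      ∀ u, dnfVal ((List.range (nFam c x.length)).flatMap fun φ => (List.range (NVn c M pT x.length)).map (E φ))
        (allTerms M c pT x) u = false := by
  classical
  obtain ⟨q₀, hq₀⟩ := Tableau.exists_tableauCircuits_acc hP M
  refine ⟨q₀.comp (bigPoly c pT), fun x => ?_⟩
  have hNV := NVn_pos c M pT x.length
  have hV : 0 < Vc M := by unfold Vc; exact Nat.card_pos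
  have hK : 0 < 3 * (succinctWidth c x.length + 2) := by omega
  have hRBeq : RBn c M pT x.length =
      S1 M (nX c x.length) (succinctWidth c x.length) (TT c pT x.length) + 1 := rfl
  have hS1 := Tableau.S1_unfold M (nX c x.length) (succinctWidth c x.length) (TT c pT x.length)
  have hd1 := Tableau.one_le_dM M
  -- the circuit of variable number `r` of family `φ` (indices clamped into range)
  have key : ∀ φ r : ℕ, ∃ E : Circuit (Fin (succinctWidth c x.length)),
      E.IsOver (accBasis m) ∧ E.acDepth ≤ d + 1 ∧ E.size ≤ (q₀.comp (bigPoly c pT)).eval x.length ∧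
      E.maxFanIn ≤ m * (succinctWidth c x.length + (q₀.comp (bigPoly c pT)).eval x.length) ∧
      (φ < nFam c x.length → r < NVn c M pT x.length → ∀ u,
        E.eval u = intended (M := M) (xq' c x (φ / 2) (decide (φ % 2 = 1))) (succinctWidth c x.length)
          (TT c pT x.length) (List.ofFn u) (r / Vc M, (valEquiv M).symm ⟨r % Vc M, Nat.mod_lt _ hV⟩)) := by
    intro φ r
    set p' := φ / 2 % (3 * (succinctWidth c x.length + 2)) with hp'
    have hp'lt : p' < 3 * (succinctWidth c x.length + 2) := Nat.mod_lt _ hK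
    set r' := r % NVn c M pT x.length with hr'
    have hr'lt : r' < NVn c M pT x.length := Nat.mod_lt _ hNV
    have hb : r' / Vc M < Rn c M pT x.length := by
      unfold NVn at hr'lt
      exact Nat.div_lt_of_lt_mul (by rwa [Nat.mul_comm] at hr'lt)
    have ht : r' / Vc M / RBn c M pT x.length ≤ TT c pT x.length := by
      unfold Rn at hb
      have := Nat.div_lt_of_lt_mul (by rwa [Nat.mul_comm] at hb)
      omega
    have hJ : r' / Vc M % RBn c M pT x.length ≤
        S1 M (nX c x.length) (succinctWidth c x.length) (TT c pT x.length) := by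
      have := Nat.mod_lt (r' / Vc M) (show 0 < RBn c M pT x.length by rw [hRBeq]; omega)
      omega
    have hlen := length_xq' c x hp'lt (decide (φ % 2 = 1))
    obtain ⟨E, hEO, hEd, hEs, hEe⟩ := hq₀ (xq' c x p' (decide (φ % 2 = 1))) (succinctWidth c x.length)
      (TT c pT x.length) (r' / Vc M / RBn c M pT x.length) (r' / Vc M % RBn c M pT x.length)
      ((valEquiv M).symm ⟨r' % Vc M, Nat.mod_lt _ hV⟩) ht (by rw [hlen]; exact hJ)
    have hsz : E.size ≤ (q₀.comp (bigPoly c pT)).eval x.length := by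
      refine hEs.trans ?_
      rw [hlen, eval_comp]
      exact natPoly_eval_mono q₀ (nX_add_le_bigPoly c pT x.length)
    refine ⟨E.normFanIn m, Circuit.isOver_normFanIn hEO, (Circuit.acDepth_normFanIn_le m E).trans hEd,
      by rwa [Circuit.size_normFanIn], (Circuit.maxFanIn_normFanIn_le hm hEO).trans
        (Nat.mul_le_mul_left m (Nat.add_le_add_left hsz _)), fun hφ hr u => ?_⟩
    · have hpp : p' = φ / 2 := Nat.mod_eq_of_lt (by unfold nFam at hφ; omega)
      have hrr : r' = r := Nat.mod_eq_of_lt hr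
      rw [Circuit.eval_normFanIn, hEe u]
      have hblk : blk M (xq' c x p' (decide (φ % 2 = 1))).length (succinctWidth c x.length)
          (TT c pT x.length) (r' / Vc M / RBn c M pT x.length) (r' / Vc M % RBn c M pT x.length) = r' / Vc M := by
        rw [hlen]
        exact Nat.div_add_mod' _ _
      rw [hblk]
      simp only [hpp, hrr]
  choose E hE using key
  refine ⟨E, fun φ r => ⟨(hE φ r).1, (hE φ r).2.1, (hE φ r).2.2.1, (hE φ r).2.2.2.1⟩, fun u => ?_⟩
  rw [dnfVal_allTerms_eq_false_iff]
  intro φ hφ hsel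
  have hp : φ / 2 < 3 * (succinctWidth c x.length + 2) := by unfold nFam at hφ; omega
  have hlen := length_xq' c x hp (decide (φ % 2 = 1))
  -- the guessed assignment of family `φ` IS the intended one on all blocks below `R`
  have agree : ∀ {φ' : ℕ} (hφ' : φ' < nFam c x.length) (bv : TVar M), bv.1 < Rn c M pT x.length →
      τ M (NVn c M pT x.length) ((List.range (nFam c x.length)).flatMap fun φ =>
        (List.range (NVn c M pT x.length)).map (E φ)) φ' u bv =
      intended (M := M) (xq' c x (φ' / 2) (decide (φ' % 2 = 1))) (succinctWidth c x.length)
        (TT c pT x.length) (List.ofFn u) bv := by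
    intro φ' hφ' bv hb
    show blockVal _ u (φ' * NVn c M pT x.length + rIdx M bv) = _
    rw [blockVal_flatMap E u hφ' (rIdx_lt c pT hb), (hE φ' (rIdx M bv)).2.2.2.2 hφ' (rIdx_lt c pT hb) u]
    have h2 : (⟨rIdx M bv % Vc M, Nat.mod_lt _ hV⟩ : Fin (Nat.card (Val M.tm))) = (valEquiv M) bv.2 :=
      Fin.ext (rIdx_mod bv)
    rw [rIdx_div, h2, Equiv.symm_apply_apply]
  -- the coordinate at position `φ / 2`, the run of the clause-bit machine and its bit
  set κ : ClauseCoord (succinctWidth c x.length) := WitnessCheck.coordOf ⟨φ / 2, hp⟩ with hκdef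
  have hκ : WitnessCheck.coordPos κ = φ / 2 := WitnessCheck.coordPos_coordOf _
  have hxq : ∀ pol', xq c x κ pol' = xq' c x (φ / 2) pol' := fun pol' => by rw [xq_eq_xq', hκ]
  have hrun : ∀ pol', M.OutputsWithin (boolPair (xq' c x (φ / 2) pol') (List.ofFn u))
      [bitFun cl (boolPair (xq' c x (φ / 2) pol') (List.ofFn u))] (TT c pT x.length) := fun pol' => by
    rw [← hxq]; exact outputsWithin_xq hM c x κ pol' u
  have hbit : ∀ pol', bitFun cl (boolPair (xq' c x (φ / 2) pol') (List.ofFn u)) =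
      xor (clauseMap _ (cl x) u κ) pol' := fun pol' => by rw [← hxq]; exact bitFun_xq cl c x κ pol' u
  -- the guard reads the clause bit
  have h0 : φ / 2 * 2 < nFam c x.length := by unfold nFam at hφ ⊢; omega
  have hoR : (outVar c M pT x.length).1 < Rn c M pT x.length :=
    Tableau.blk_lt M _ _ _ le_rfl (by omega)
  have hout : blockVal ((List.range (nFam c x.length)).flatMap fun φ =>
      (List.range (NVn c M pT x.length)).map (E φ)) u (φ / 2 * 2 * NVn c M pT x.length + rOut c M pT x.length) =
      clauseMap _ (cl x) u κ := by
    have h1 : φ / 2 * 2 * NVn c M pT x.length + rOut c M pT x.length =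
        φ / 2 * 2 * NVn c M pT x.length + rIdx M (outVar c M pT x.length) := rfl
    have h2 := agree h0 (outVar c M pT x.length) hoR
    unfold τ at h2
    rw [h1, h2, show φ / 2 * 2 / 2 = φ / 2 by omega, show decide (φ / 2 * 2 % 2 = 1) = false by simp]
    unfold outVar
    rw [← length_xq' c x hp false, Tableau.intended_outVar (hrun false), hbit false, Bool.xor_false]
  -- hence the clause-bit machine accepts `⟨x'_{p,pol}, u⟩`
  have hf : bitFun cl (boolPair (xq' c x (φ / 2) (decide (φ % 2 = 1))) (List.ofFn u)) = true := by
    rw [hbit]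
    rw [litVal_selLit, hout] at hsel
    exact hsel
  have hcl := Tableau.complete (M := M) (x := xq' c x (φ / 2) (decide (φ % 2 = 1)))
    (P := succinctWidth c x.length) (T := TT c pT x.length) (u := List.ofFn u) (by simp) (hrun _) hf
  refine ⟨fun C hC => ?_, fun j hj => ?_⟩
  · rw [Tableau.HClause.holds_congr fun bv hbv => agree hφ bv ?_]
    · exact hcl C hC
    · have := Tableau.fst_lt_of_mem_clauses M hC hbv
      rwa [hlen] at this
  · have hpin := Tableau.pinned_intended (M := M) (x := xq' c x (φ / 2) (decide (φ % 2 = 1)))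
      (P := succinctWidth c x.length) (T := TT c pT x.length) (u := List.ofFn u) (by simp) j hj
    rw [agree hφ]
    · exact hpin
    · simp only [List.length_ofFn] at hj
      rw [hlen]
      exact Tableau.blk_lt M _ _ _ (Nat.zero_le _) (by omega)

end Complete

end MachineA

end Literature.Computability.Complexity
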